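import Summits.BirchSwinnertonDyer.BirchSwinnertonDyer.Theorems.GenusKolyvaginAtTwoMinimalTwinBSDTwoOddCutOfDeepWitness
import Summits.BirchSwinnertonDyer.BirchSwinnertonDyer.Theorems.GenusKolyvaginAtTwoPowDvdShaCardAtTwoPosT
import Summits.BirchSwinnertonDyer.BirchSwinnertonDyer.Theorems.GenusKolyvaginAtTwoGenusPrimitiveSupplyAtTwoConjugationTypeAtTwo
import HarnessLib

/-!
# Route `GenusKolyvaginAtTwo`, crux U₂ `MinimalTwinBSDTwo` (stmt-BirchSwinnertonDyer-22985), LINE 23 «twin_swap» — THE ON-CUT BRANCH MADE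
# SIGN-FREE: KEX′ and U₂ on the WHOLE odd habitat cut (either sign of `Δ`) from ONE TRANSPOSITION-deep Kolyvagin witness for the rank-one member

Seat `bsd-line-gk2-p2` g32 (PROVER seat 2/3, cell `bsd-f1-sign2`, LINE 23 holder), `--supports stmt-BirchSwinnertonDyer-22985 --as helper`.
THEOREMS ONLY (no definition, no named fact, no `sorry`).  BSD is NOT proved by any of this; U₂ is NOT proved; nothing is closed.  Every theorem is
CONDITIONAL on its displayed hypotheses (Q2 `KolyvaginRelationAtTwo` = item 24880; the PRINT facts GZ / GZK / modularity / Milne of LINE 23; the twin's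
`BSD₂`; and a TRANSPOSITION-deep Kolyvagin witness for the rank-one member).

THE OBSERVATION (sequel of g31's `…OddCutOfDeepWitness`, p810945, which read the route's CLOSED `Δ < 0` lower half L_T for the `ε = −1` member).
The route's CLOSED `Δ > 0` lower half L⁺_T′ `PowDvdShaCardAtTwoPosT` (stmt-BirchSwinnertonDyer-25501, `powDvdShaCardAtTwoPosT_proof`, road (E4)⁺) is
proved through the capstone `PlusDescent.pow_dvd_natCard_sha_of_sockets_of_rank_le_one_transposition` (gk2-p2 g22, p758597), whose text carries
NEITHER a sign of `Δ` NOR a root number NOR a twin: its only rank input is `rank W(K) ≤ 1`, and its Kolyvagin witness is a square-free `n` of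
TRANSPOSITION-deep primes (Zhang-admissible at `2`, index `≥ 2`, an arithmetic Frobenius at `ℓ` MOVES a point of `W[2]`) with `P(n) ∉ 2W(K[n])`.  In
`powDvdShaCardAtTwoPosT_proof` the binders `w(W) = +1` and the `Sel₂`-minimal twin serve ONLY to produce `rank W(K) ≤ 1`, and `0 < Δ` is idle.  Hence:

* §1 `pow_dvd_natCard_sha_baseChange_of_transpositionWitness_of_rank_le_one` — **ROOT-NUMBER-FREE, SIGN-FREE lower half**: on the habitat (non-CM,
  `C(W)` odd, an odd multiplicative prime, `ρ_{W,2^∞}` onto; `K` odd `d_K ≠ −3` Heegner with the two Theorem-B exclusions; `P(1)` of infinite order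
  with exact depth `M₀`) and `rank W(K) ≤ 1`, ONE transposition-deep witness forces **`4^{M₀} ∣ #Ш(W_K)[2^∞]`**, modulo Q2 only.  (= the body of
  `powDvdShaCardAtTwoPosT_proof` with `hrk` displayed; reusable verbatim by the Ш-cell 27477 / LINE 42, whose member is also rank one.)
* §2 `mordellWeilRank_baseChange_le_one_of_selmerTwo_signFree` — for the RANK-ONE member of LINE 23: `#Sel₂(W) = 2 ⟹ rank W(ℚ) ≤ 1` (descent count)
  and `rank W^{(d_K)}(ℚ) = 0` (g31's `mordellWeilRank_twist_eq_zero_signFree`, Kolyvagin's Thm. B rank part for the twin, `w(W) = −1`, either sign of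
  `Δ`, mod Q2) ⟹ **`rank W(K) ≤ 1`**; hence §2′ `pow_dvd_natCard_sha_baseChange_of_transpositionWitness_signFree` — the lower half for the `ε = −1` member,
  EITHER SIGN of `Δ`, mod Q2 only.
* §3 `natCard_sha_baseChange_mul_eq_pow_onOddCut_of_transpositionWitness` — **KEX′'s conclusion `#Ш(W_K)[2^∞]·2^{2(ord₂c+ord₂C(W))} = 2^{2M₀}` on the
  WHOLE odd habitat cut inside the genus budget `(Δ < 0 ∧ ord₂ C(Wd) ≤ 1) ∨ ord₂ C(Wd) = 0`**, from ONE transposition-deep witness, modulo Q2 ONLY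
  (upper half = g31's `finite_and_natCard_primaryComponent_sha_baseChange_two_dvd_pow_of_derivedPoint_signFree`).
* §4 `bsdp_onOddCut_of_transpositionWitness_of_facts` — `BSD₂(Wd) → BSD₂(W)` there (g27's per-frame descent), mod Q2 + GZ + GZK + modularity + Milne.
* §5 `minimalTwinBSDTwo_onOddCut_of_wall_of_transpositionWitnessSupply_of_facts` — the census form: **U₂ restricted to the WHOLE odd habitat cut
  (both signs of `Δ`) ⟸ WALL row 1 + PRINT + Q2 + a TRANSPOSITION-WITNESS SUPPLY^±** (per `W`: one odd Heegner frame `≠ ℚ(√−3)`, an odd-`c` datum with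
  `P(1)` of infinite order and its exact depth, a globally minimal twin model inside the budget, and a transposition-deep witness).
* §6 `transpositionDeep_of_frobInftyDeep_of_Δ_neg` — on `Δ < 0` a `Frob_ℓ = Frob_∞` prime IS a transposition prime (complex conjugation moves a point
  of `W[2]`: `GenusKolySign.exists_twoTorsion_frob_smul_ne_of_frobEqFrobInfty_of_Δ_neg`), so g31's SUPPLY⁻ (Frob_∞-deep witnesses on the `Δ < 0` cut)
  is the `Δ < 0` case of SUPPLY^± (g31's §3 `minimalTwinBSDTwo_onOddNegCut_of_wall_of_witnessSupply_of_facts` = §5 ∘ §6 with budget branch 1).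

HONEST FRAMING.  Nothing beyond print is proved; the witness supply is OPEN (it is the `ε = −1` mirror of the route's K₄ supplies, now for both signs);
what is gained is bookkeeping: the ON-cut branch of LINE 23 no longer needs `Δ < 0`, and its one research statement is typed in the same currency
(transposition-deep witness) as the route's closed L⁺_T′.  BSD is NOT proved.

References: [Kolyvagin1989Izv] Thm. A, Thm. B_l; [Kolyvagin1991MathAnn] Thm. 2.1–2.2 (structure theorem); [McCallumLMS1991] §5 Prop. 5.2, Thm. 5.4,
Thm. 5.8; [GrossLMS1991] §3 (3.1)–(3.3), §5, §10; [GrossZagier1986] V.§2 (2.2); [Milne1972ArithmeticAV] §1 Thm. 1; [SilvermanAEC2009] Thm. X.4.2 (a),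
Exercise 10.16; [WZhang2014] Thm. 1.1 (the shape of the witness at p ≥ 5).
-/

set_option autoImplicit false
set_option linter.dupNamespace false -- `Summit.<P>.<Sub>` repeats `BirchSwinnertonDyer` (D-0017)

noncomputable section

open scoped Classical

namespace Summit.BirchSwinnertonDyer.BirchSwinnertonDyer.Theorems.GenusExact.TwinSwap.TwinAnnihilation

open Literature.NumberTheory.EllipticCurves Literature.NumberTheory.GaloisRepresentations WeierstrassCurve NumberField
  IsDedekindDomain Field AddSubgroup Literature.NumberTheory.EllipticCurves.ModularForms
open Literature.NumberTheory.GaloisCohomology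
open Summit.BirchSwinnertonDyer.Rank1Residual.JET.GlobalDuality
open Summit.BirchSwinnertonDyer.Rank1Residual
open Summit.BirchSwinnertonDyer.BirchSwinnertonDyer.Theses.GenusKolyvaginAtTwo (KolyvaginRelationAtTwo)
open Summit.BirchSwinnertonDyer.BirchSwinnertonDyer.Theorems.GenusExact.PlusDescent

/-! ## §1 The root-number-free, sign-free lower half from one transposition-deep witness -/

/-- **ROOT-NUMBER-FREE, SIGN-FREE LOWER HALF: `4^{M₀} ∣ #Ш(W_K)[2^∞]` from ONE TRANSPOSITION-deep Kolyvagin witness, given `rank W(K) ≤ 1`**, modulo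
Q2 only.  Frame: `W/ℚ` globally minimal, non-CM, `C(W)` odd, an odd prime `v` of multiplicative reduction, `ρ_{W,2^n}` onto; `K` imaginary quadratic,
`d_K` odd `≠ −3`, Heegner, the two Theorem-B exclusions; a datum `Dt`, `P(1)` of infinite order with exact depth `M₀`; `rank W(K) ≤ 1`; a square-free
`n₀` all of whose primes are Zhang–Kolyvagin-admissible at `2` with `kolyvaginIndex ≥ 2` AND carry an arithmetic Frobenius moving a point of `W[2]`,
with `P(n₀) ∉ 2W(K[n₀])`.  Proof = the body of the route's CLOSED `powDvdShaCardAtTwoPosT_proof` (road (E4)⁺: capstone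
`pow_dvd_natCard_sha_of_sockets_of_rank_le_one_transposition` fed by the four landed sockets), with its rank input displayed instead of derived from
`w = +1`; NO sign of `Δ`, NO root number, NO twin.  CONDITIONAL on Q2; BSD is NOT proved.
(Proof adapted from `powDvdShaCardAtTwoPosT_proof`, gk2-p2 g22.)
[cite: McCallumLMS1991, §5 Prop. 5.2, Thm. 5.4 (p. 310)] [cite: Kolyvagin1991MathAnn, Thm. 2.1–2.2] [cite: GrossLMS1991, §3 (3.1)–(3.3), §10]
[cite: Kolyvagin1989Izv, Thm. B₂] -/
theorem pow_dvd_natCard_sha_baseChange_of_transpositionWitness_of_rank_le_one (hQ2 : KolyvaginRelationAtTwo)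
    (W : WeierstrassCurve ℚ) [W.IsElliptic] [W.IsGloballyMinimal] [NeZero (W.conductorNorm ℤ)] (hcm : ¬ W.HasCM)
    (hT : Odd W.tamagawaProduct) (v : HeightOneSpectrum (𝓞 ℚ)) (h2v : ((2 : ℕ) : 𝓞 ℚ) ∉ v.asIdeal)
    (hNv : ((W.conductorNorm ℤ : ℕ) : 𝓞 ℚ) ∈ v.asIdeal) (hmult : W.HasMultiplicativeReductionAt v)
    (K : Type) [Field K] [NumberField K] (hIQ : IsImaginaryQuadratic K) (hodd : Odd (NumberField.discr K))
    (h3 : NumberField.discr K ≠ -3) (hHe : SatisfiesHeegnerHypothesis (W.conductorNorm ℤ) K)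
    (hsq1 : ¬ IsSquare ((NumberField.discr K : ℚ) * -|W.Δ|)) (hsq2 : ¬ IsSquare ((NumberField.discr K : ℚ) * (-(2 * |W.Δ|))))
    (hρ : ∀ n : ℕ, 0 < n → W.HasSurjectiveModNGaloisRep ((2 : ℤ) ^ n))
    (Dt : ModularParametrizationData W (W.conductorNorm ℤ)) (β : ℤ) (ι : K →+* ℂ) (d₁ : KolyvaginHeegnerData Dt β ι 1)
    (hy : ¬ IsOfFinAddOrder d₁.derivedPoint) (M₀ : ℕ)
    (hdiv : ∃ Q : (W.baseChange (ringClassField K ι 1)).toAffine.Point, ((2 ^ M₀ : ℕ) : ℤ) • Q = d₁.derivedPoint)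
    (hndiv : ¬ ∃ Q : (W.baseChange (ringClassField K ι 1)).toAffine.Point, ((2 ^ (M₀ + 1) : ℕ) : ℤ) • Q = d₁.derivedPoint)
    (hrk : (W.baseChange K).mordellWeilRank ≤ 1)
    (n₀ : ℕ) (e₀ : KolyvaginHeegnerData Dt β ι n₀) (hn₀ : Squarefree n₀)
    (hKoly : ∀ ℓ ∈ n₀.primeFactors, Zhang2014.IsKolyvaginPrime (W.conductorNorm ℤ) W K 2 ℓ ∧ 2 ≤ Zhang2014.kolyvaginIndex W 2 ℓ ∧
      ∃ (v : HeightOneSpectrum (𝓞 ℚ)) (𝔓 : Ideal (absIntegers (𝓞 ℚ) ℚ)) (h : absoluteGaloisGroup ℚ),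
        ((ℓ : ℕ) : 𝓞 ℚ) ∈ v.asIdeal ∧ 𝔓 ∈ v.primesAbove ∧ IsArithFrobAt (𝓞 ℚ) h 𝔓 ∧ ∃ u : W.geomTorsion ((2 : ℕ) : ℤ), h • u ≠ u)
    (he₀ : ¬ ∃ Q : (W.baseChange (ringClassField K ι n₀)).toAffine.Point, (2 : ℤ) • Q = e₀.derivedPoint) :
    2 ^ (2 * M₀) ∣ Nat.card (AddCommGroup.primaryComponent (W.baseChange K).sha 2) := by
  obtain ⟨τ, hτ, -⟩ := exists_conj_of_isImaginaryQuadratic (K := K) hIQ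
  haveI : ∀ j : ℕ, NumberField (ringClassField K ι j) := JET.numberField_ringClassField K hIQ ι
  have hsurN' : ∀ m : ℕ, W.HasSurjectiveModNGaloisRep (2 ^ m : ℕ) := fun m ↦ by
    exact_mod_cast Summit.BirchSwinnertonDyer.BirchSwinnertonDyer.Theorems.MinimalTwinBSDTwo.forall_hasSurjectiveModNGaloisRep_two_pow_of_pos W hρ m
  -- the witness clause in the Theorems' spelling (`geomTorsion W 2`)
  have hKoly' : ∀ ℓ ∈ n₀.primeFactors, Zhang2014.IsKolyvaginPrime (W.conductorNorm ℤ) W K 2 ℓ ∧ 2 ≤ Zhang2014.kolyvaginIndex W 2 ℓ ∧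
      ∃ (v : HeightOneSpectrum (𝓞 ℚ)) (𝔓 : Ideal (absIntegers (𝓞 ℚ) ℚ)) (h : absoluteGaloisGroup ℚ),
        (ℓ : 𝓞 ℚ) ∈ v.asIdeal ∧ 𝔓 ∈ v.primesAbove ∧ IsArithFrobAt (𝓞 ℚ) h 𝔓 ∧ ∃ u : geomTorsion W 2, h • u ≠ u := by
    intro ℓ hℓ
    obtain ⟨hZ, hidx, v', 𝔓, h, hv', h𝔓, hfr, hu⟩ := hKoly ℓ hℓ
    exact ⟨hZ, hidx, v', 𝔓, h, hv', h𝔓, hfr, exists_smul_ne_two_of_natCast W hu⟩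
  exact pow_dvd_natCard_sha_of_sockets_of_rank_le_one_transposition hQ2 W hcm hT v h2v hNv hmult K hIQ hodd h3 hHe hsq1 hsq2 hρ Dt β ι d₁ hy
    M₀ hdiv hndiv hrk τ hτ
    (exists_transposition_kolyvaginPrime_localization_fullOrder_pair_deep W K hIQ hodd hHe hsurN' τ hτ (2 * (M₀ + 6)) 1 (by omega))
    (GenusExact.TransverseValue.hbot_socket_margin_onHabitat_of_three_le_transposition W hQ2 hcm hT hsurN' hIQ hodd h3 hHe hsq1 hsq2 h2v hNv hmult
      Dt β ι (L := 2 * (M₀ + 6)) (by omega) 1 (by omega) _ (fun q _ hidx hF ↦ ⟨hidx, hF⟩) hn₀ hKoly' e₀ he₀)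
    (deepSwap_socket_transposition W hcm hT hsurN' hIQ hodd h3 hHe τ hτ Dt β ι hQ2 (M₀ := M₀) (L := 2 * (M₀ + 6)) (k := 1) (by omega) le_rfl
      (Summit.BirchSwinnertonDyer.BirchSwinnertonDyer.Theorems.GenusExact.NonPhantomPow.nonPhantomAtTwo_of_hasMultiplicativeReductionAt W hT hρ hIQ
        hodd hsq1 hsq2 (NeZero.ne (W.conductorNorm ℤ)) hHe h2v hNv hmult (2 * (M₀ + 6) + 1) (by omega)))
    (fun r ℓ hℓ C hC ↦ hK_socket_margin_of_frob_smul_ne W hIQ hτ (L := 2 * (M₀ + 6)) (by omega) r 1 ℓ hℓ C hC)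

/-! ## §2 The rank-one member: `rank W(K) ≤ 1` from `#Sel₂(W) = 2` and Kolyvagin's Theorem B for the twin -/

/-- `#Sel₂(E) = 2 ⟹ rank E(F) ≤ 1` for an elliptic curve over a number field: the descent count `#Sel₂ = 2^{rank} · #E(F)[2] · #(Ш ⊓ H¹[2])`
(tree `card_selmerGroup_eq_pow_rank_mul`). (Rank bookkeeping adapted from gk2-p2 g22's `mordellWeilRank_baseChange_le_one_onPosCut`.)
[cite: SilvermanAEC2009, Thm. X.4.2 (a)] -/
theorem mordellWeilRank_le_one_of_natCard_selmerGroup_two_eq_two {F : Type*} [Field F] [NumberField F] (V : WeierstrassCurve F) [V.IsElliptic]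
    (hSel : Nat.card (V.selmerGroup 2) = 2) : V.mordellWeilRank ≤ 1 := by
  have hcount := card_selmerGroup_eq_pow_rank_mul V 2
  simp only [Nat.cast_ofNat] at hcount
  rw [hSel] at hcount
  have hdvd : 2 ^ V.mordellWeilRank ∣ 2 := Dvd.intro _ (by rw [mul_assoc] at hcount; exact hcount.symm)
  have hle := Nat.le_of_dvd two_pos hdvd
  by_contra h
  have h4 : 4 ≤ 2 ^ V.mordellWeilRank := by
    calc 4 = 2 ^ 2 := by norm_num
      _ ≤ 2 ^ V.mordellWeilRank := Nat.pow_le_pow_right (by norm_num) (by omega)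
  omega

/-- **`rank W(K) ≤ 1` for the RANK-ONE member of LINE 23 on the habitat, EITHER SIGN of `Δ`, modulo Q2**: `rank W(K) = rank W(ℚ) + rank W^{(d_K)}(ℚ)`
(Silverman X.10.16), `rank W(ℚ) ≤ 1` from `#Sel₂(W) = 2`, and `rank W^{(d_K)}(ℚ) = 0` from g31's `mordellWeilRank_twist_eq_zero_signFree` (Kolyvagin's
Theorem B, rank part, case `A = E^D`, with `w(W) = −1`).  No Gross–Zagier, no GZK, no analytic rank.
[cite: Kolyvagin1989Izv, Thm. B] [cite: SilvermanAEC2009, Thm. X.4.2 (a), Exercise 10.16] -/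
theorem mordellWeilRank_baseChange_le_one_of_selmerTwo_signFree (hQ2 : KolyvaginRelationAtTwo)
    (W : WeierstrassCurve ℚ) [W.IsElliptic] [W.IsGloballyMinimal] [NeZero (W.conductorNorm ℤ)] (hcm : ¬ W.HasCM)
    (hT : Odd W.tamagawaProduct) (v : HeightOneSpectrum (𝓞 ℚ)) (h2v : ((2 : ℕ) : 𝓞 ℚ) ∉ v.asIdeal)
    (hNv : ((W.conductorNorm ℤ : ℕ) : 𝓞 ℚ) ∈ v.asIdeal) (hmult : W.HasMultiplicativeReductionAt v)
    (K : Type) [Field K] [NumberField K] (hIQ : IsImaginaryQuadratic K) (hodd : Odd (NumberField.discr K))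
    (h3 : NumberField.discr K ≠ -3) (hHe : SatisfiesHeegnerHypothesis (W.conductorNorm ℤ) K)
    (hsq1 : ¬ IsSquare ((NumberField.discr K : ℚ) * -|W.Δ|)) (hsq2 : ¬ IsSquare ((NumberField.discr K : ℚ) * (-(2 * |W.Δ|))))
    (hρ : ∀ n : ℕ, 0 < n → W.HasSurjectiveModNGaloisRep ((2 : ℤ) ^ n))
    (Dt : ModularParametrizationData W (W.conductorNorm ℤ)) (β : ℤ) (ι : K →+* ℂ) (d₁ : KolyvaginHeegnerData Dt β ι 1) (M₀ : ℕ)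
    (hndiv : ¬ ∃ Q : (W.baseChange (ringClassField K ι 1)).toAffine.Point, ((2 ^ (M₀ + 1) : ℕ) : ℤ) • Q = d₁.derivedPoint)
    (hw : W.rootNumber = -1) (hSel : Nat.card (W.selmerGroup 2) = 2) :
    (W.baseChange K).mordellWeilRank ≤ 1 := by
  have hdK0 : ((NumberField.discr K : ℤ) : ℚ) ≠ 0 := by exact_mod_cast NumberField.discr_ne_zero K
  haveI hTell : (W.quadraticTwist ((NumberField.discr K : ℤ) : ℚ)).IsElliptic := W.isElliptic_quadraticTwist hdK0
  haveI hEK : (W.baseChange K).IsElliptic := inferInstanceAs ((W.map (algebraMap ℚ K)).IsElliptic)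
  haveI : Module.Finite ℤ (W.baseChange K).toAffine.Point := (W.baseChange K).module_finite_point_holds
  have hsum := W.mordellWeilRank_baseChange_of_finrank_eq_two_of_finite K hIQ.1
  have hT0 := mordellWeilRank_twist_eq_zero_signFree hQ2 W hcm hT v h2v hNv hmult K hIQ hodd h3 hHe hsq1 hsq2 hρ Dt β ι d₁ M₀ hndiv hw
  rw [hT0, add_zero] at hsum
  rw [hsum]
  exact mordellWeilRank_le_one_of_natCard_selmerGroup_two_eq_two W hSel

/-- **THE LOWER HALF FOR THE `ε = −1` MEMBER, EITHER SIGN OF `Δ`: `4^{M₀} ∣ #Ш(W_K)[2^∞]` from ONE transposition-deep witness**, modulo Q2 only — §1 fed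
by §2 (`w(W) = −1`, `#Sel₂(W) = 2`); the two Theorem-B field exclusions are automatic for an odd Heegner `d_K` (gk2-p2 g7
`kolyvaginExclusions_of_odd_of_satisfiesHeegnerHypothesis`).  CONDITIONAL on Q2 and the witness; BSD is NOT proved.
[cite: Kolyvagin1991MathAnn, Thm. 2.1–2.2] [cite: McCallumLMS1991, §5 Prop. 5.2, Thm. 5.4] [cite: Kolyvagin1989Izv, Thm. B] -/
theorem pow_dvd_natCard_sha_baseChange_of_transpositionWitness_signFree (hQ2 : KolyvaginRelationAtTwo)
    (W : WeierstrassCurve ℚ) [W.IsElliptic] [W.IsGloballyMinimal] [NeZero (W.conductorNorm ℤ)] (hcm : ¬ W.HasCM)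
    (hT : Odd W.tamagawaProduct) (v : HeightOneSpectrum (𝓞 ℚ)) (h2v : ((2 : ℕ) : 𝓞 ℚ) ∉ v.asIdeal)
    (hNv : ((W.conductorNorm ℤ : ℕ) : 𝓞 ℚ) ∈ v.asIdeal) (hmult : W.HasMultiplicativeReductionAt v)
    (K : Type) [Field K] [NumberField K] (hIQ : IsImaginaryQuadratic K) (hodd : Odd (NumberField.discr K))
    (h3 : NumberField.discr K ≠ -3) (hHe : SatisfiesHeegnerHypothesis (W.conductorNorm ℤ) K)
    (hρ : ∀ n : ℕ, 0 < n → W.HasSurjectiveModNGaloisRep ((2 : ℤ) ^ n))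
    (Dt : ModularParametrizationData W (W.conductorNorm ℤ)) (β : ℤ) (ι : K →+* ℂ) (d₁ : KolyvaginHeegnerData Dt β ι 1)
    (hy : ¬ IsOfFinAddOrder d₁.derivedPoint) (M₀ : ℕ)
    (hdiv : ∃ Q : (W.baseChange (ringClassField K ι 1)).toAffine.Point, ((2 ^ M₀ : ℕ) : ℤ) • Q = d₁.derivedPoint)
    (hndiv : ¬ ∃ Q : (W.baseChange (ringClassField K ι 1)).toAffine.Point, ((2 ^ (M₀ + 1) : ℕ) : ℤ) • Q = d₁.derivedPoint)
    (hw : W.rootNumber = -1) (hSel : Nat.card (W.selmerGroup 2) = 2)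
    (n₀ : ℕ) (e₀ : KolyvaginHeegnerData Dt β ι n₀) (hn₀ : Squarefree n₀)
    (hKoly : ∀ ℓ ∈ n₀.primeFactors, Zhang2014.IsKolyvaginPrime (W.conductorNorm ℤ) W K 2 ℓ ∧ 2 ≤ Zhang2014.kolyvaginIndex W 2 ℓ ∧
      ∃ (v : HeightOneSpectrum (𝓞 ℚ)) (𝔓 : Ideal (absIntegers (𝓞 ℚ) ℚ)) (h : absoluteGaloisGroup ℚ),
        ((ℓ : ℕ) : 𝓞 ℚ) ∈ v.asIdeal ∧ 𝔓 ∈ v.primesAbove ∧ IsArithFrobAt (𝓞 ℚ) h 𝔓 ∧ ∃ u : W.geomTorsion ((2 : ℕ) : ℤ), h • u ≠ u)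
    (he₀ : ¬ ∃ Q : (W.baseChange (ringClassField K ι n₀)).toAffine.Point, (2 : ℤ) • Q = e₀.derivedPoint) :
    2 ^ (2 * M₀) ∣ Nat.card (AddCommGroup.primaryComponent (W.baseChange K).sha 2) := by
  obtain ⟨hsq1, hsq2⟩ := kolyvaginExclusions_of_odd_of_satisfiesHeegnerHypothesis W hIQ hodd hHe
  exact pow_dvd_natCard_sha_baseChange_of_transpositionWitness_of_rank_le_one hQ2 W hcm hT v h2v hNv hmult K hIQ hodd h3 hHe hsq1 hsq2 hρ Dt β ι d₁
    hy M₀ hdiv hndiv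
    (mordellWeilRank_baseChange_le_one_of_selmerTwo_signFree hQ2 W hcm hT v h2v hNv hmult K hIQ hodd h3 hHe hsq1 hsq2 hρ Dt β ι d₁ M₀ hndiv hw hSel)
    n₀ e₀ hn₀ hKoly he₀

/-! ## §3 KEX′ on the whole odd habitat cut from one transposition-deep witness -/

/-- **KEX′'s conclusion on the WHOLE odd habitat cut from ONE transposition-deep witness, modulo Q2 only**: frame of §2′ plus `Dt.c` odd and an elliptic
model `Wd ≅ W^{(d_K)}` inside the genus budget `(Δ_W < 0 ∧ ord₂ C(Wd) ≤ 1) ∨ ord₂ C(Wd) = 0`.  Then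
**`#Ш(W_K)[2^∞] · 2^{2(ord₂ c + ord₂ C(W))} = 2^{2M₀}`**: upper divisibility = g31's
`finite_and_natCard_primaryComponent_sha_baseChange_two_dvd_pow_of_derivedPoint_signFree` (the swapped sign-free Kolyvagin-B₂ engine + RANKQ⁻± + the
pair sandwich), lower = §2′.  EITHER SIGN of `Δ`.  CONDITIONAL; BSD is NOT proved.
[cite: Kolyvagin1989Izv, Thm. B_l] [cite: Kolyvagin1991MathAnn, Thm. 2.1–2.2] [cite: McCallumLMS1991, §5 Thm. 5.4, Thm. 5.8] [cite: MazurRubin2010, Cor. 3.4 (i)] -/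
theorem natCard_sha_baseChange_mul_eq_pow_onOddCut_of_transpositionWitness (hQ2 : KolyvaginRelationAtTwo)
    (W : WeierstrassCurve ℚ) [W.IsElliptic] [W.IsGloballyMinimal] [NeZero (W.conductorNorm ℤ)] (hcm : ¬ W.HasCM)
    (hT : Odd W.tamagawaProduct) (v : HeightOneSpectrum (𝓞 ℚ)) (h2v : ((2 : ℕ) : 𝓞 ℚ) ∉ v.asIdeal)
    (hNv : ((W.conductorNorm ℤ : ℕ) : 𝓞 ℚ) ∈ v.asIdeal) (hmult : W.HasMultiplicativeReductionAt v)
    (K : Type) [Field K] [NumberField K] (hK : IsImaginaryQuadratic K) (hodd : Odd (NumberField.discr K))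
    (h3 : NumberField.discr K ≠ -3) (hH : SatisfiesHeegnerHypothesis (W.conductorNorm ℤ) K)
    (hρ : ∀ n : ℕ, 0 < n → W.HasSurjectiveModNGaloisRep ((2 : ℤ) ^ n))
    (Dt : ModularParametrizationData W (W.conductorNorm ℤ)) (hc : Odd Dt.c) (β : ℤ) (ι : K →+* ℂ) (d₁ : KolyvaginHeegnerData Dt β ι 1)
    (hy : ¬ IsOfFinAddOrder d₁.derivedPoint) (M₀ : ℕ)
    (hdiv : ∃ Q : (W.baseChange (ringClassField K ι 1)).toAffine.Point, ((2 ^ M₀ : ℕ) : ℤ) • Q = d₁.derivedPoint)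
    (hndiv : ¬ ∃ Q : (W.baseChange (ringClassField K ι 1)).toAffine.Point, ((2 ^ (M₀ + 1) : ℕ) : ℤ) • Q = d₁.derivedPoint)
    (hw : W.rootNumber = -1) (hSel : Nat.card (W.selmerGroup 2) = 2)
    {Wd : WeierstrassCurve ℚ} [Wd.IsElliptic] (Cd : VariableChange ℚ) (hWd : Cd • W.quadraticTwist (NumberField.discr K : ℚ) = Wd)
    (hbudget : (W.Δ < 0 ∧ padicValNat 2 Wd.tamagawaProduct ≤ 1) ∨ padicValNat 2 Wd.tamagawaProduct = 0)
    (n₀ : ℕ) (e₀ : KolyvaginHeegnerData Dt β ι n₀) (hn₀ : Squarefree n₀)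
    (hKoly : ∀ ℓ ∈ n₀.primeFactors, Zhang2014.IsKolyvaginPrime (W.conductorNorm ℤ) W K 2 ℓ ∧ 2 ≤ Zhang2014.kolyvaginIndex W 2 ℓ ∧
      ∃ (v : HeightOneSpectrum (𝓞 ℚ)) (𝔓 : Ideal (absIntegers (𝓞 ℚ) ℚ)) (h : absoluteGaloisGroup ℚ),
        ((ℓ : ℕ) : 𝓞 ℚ) ∈ v.asIdeal ∧ 𝔓 ∈ v.primesAbove ∧ IsArithFrobAt (𝓞 ℚ) h 𝔓 ∧ ∃ u : W.geomTorsion ((2 : ℕ) : ℤ), h • u ≠ u)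
    (he₀ : ¬ ∃ Q : (W.baseChange (ringClassField K ι n₀)).toAffine.Point, (2 : ℤ) • Q = e₀.derivedPoint) :
    Nat.card (AddCommGroup.primaryComponent (W.baseChange K).sha 2) *
        2 ^ (2 * (padicValInt 2 Dt.c + padicValNat 2 W.tamagawaProduct)) = 2 ^ (2 * M₀) := by
  haveI : Fact (Nat.Prime 2) := ⟨Nat.prime_two⟩
  have hc2 : padicValInt 2 Dt.c = 0 :=
    padicValInt.eq_zero_of_not_dvd fun h ↦ (Int.not_even_iff_odd.mpr hc) (even_iff_two_dvd.mpr (by exact_mod_cast h))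
  have hC2 : padicValNat 2 W.tamagawaProduct = 0 :=
    padicValNat.eq_zero_of_not_dvd fun h ↦ (Nat.not_even_iff_odd.mpr hT) (even_iff_two_dvd.mpr h)
  rw [hc2, hC2, add_zero, mul_zero, pow_zero, mul_one]
  refine Nat.dvd_antisymm ?_ ?_
  · -- the upper half: g31's swapped sign-free engine (B2Q⁻±) + RANKQ⁻± + sandwich, modulo Q2 only
    exact (finite_and_natCard_primaryComponent_sha_baseChange_two_dvd_pow_of_derivedPoint_signFree hQ2 W hcm hT v h2v hNv hmult K hK hodd h3 hH
      hρ Dt β ι d₁ hy M₀ hndiv hw hSel Cd hWd hbudget).2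
  · -- the lower half: §2′ (road (E4)⁺ read for the `ε = −1` member, either sign)
    exact pow_dvd_natCard_sha_baseChange_of_transpositionWitness_signFree hQ2 W hcm hT v h2v hNv hmult K hK hodd h3 hH hρ Dt β ι d₁ hy M₀ hdiv
      hndiv hw hSel n₀ e₀ hn₀ hKoly he₀

/-! ## §4 `BSD₂(Wd) → BSD₂(W)` on that frame -/

/-- **`BSD₂(Wd) → BSD₂(W)` on the WHOLE odd habitat cut from ONE transposition-deep witness**, modulo Q2 and LINE 23's four PRINT facts (GZ all levels,
GZK, modularity, Milne any-model): §3 gives the exactness-shaped input of g27's per-frame swapped exact descent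
`AnalyticTwin.swappedPairDescentAtTwo_shaDepth_anyTwin_of_facts`; `w(W) = −1` from `r_an(W) = 1`.  CONDITIONAL; closes nothing; BSD is NOT proved.
[cite: GrossZagier1986, V.§2 (2.2)] [cite: Milne1972ArithmeticAV, §1 Thm. 1] [cite: Kolyvagin1989Izv, Thm. B_l] [cite: McCallumLMS1991, §5 Thm. 5.4, Thm. 5.8] -/
theorem bsdp_onOddCut_of_transpositionWitness_of_facts (hQ2 : KolyvaginRelationAtTwo)
    (hGZ : ∀ (N : ℕ) [NeZero N] (W : WeierstrassCurve ℚ) (K : Type) [Field K] [NumberField K], gross_zagier N W K)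
    (hGZK : rank_eq_analyticRank_of_analyticRank_le_one) (hmod : hasEntireLFunction_rat)
    (hMilneC : Milne1972.bsdQuotient_baseChange_quadratic_anyModel)
    (W : WeierstrassCurve ℚ) [W.IsElliptic] [W.IsGloballyMinimal] [NeZero (W.conductorNorm ℤ)] (hcm : ¬ W.HasCM)
    (hr : W.analyticRank = 1) (hSel : Nat.card (W.selmerGroup 2) = 2)
    (hT : Odd W.tamagawaProduct) (v : HeightOneSpectrum (𝓞 ℚ)) (h2v : ((2 : ℕ) : 𝓞 ℚ) ∉ v.asIdeal)
    (hNv : ((W.conductorNorm ℤ : ℕ) : 𝓞 ℚ) ∈ v.asIdeal) (hmult : W.HasMultiplicativeReductionAt v)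
    (hρ : ∀ n : ℕ, 0 < n → W.HasSurjectiveModNGaloisRep ((2 : ℤ) ^ n))
    (K : Type) [Field K] [NumberField K] (hK : IsImaginaryQuadratic K) (hodd : Odd (NumberField.discr K))
    (h3 : NumberField.discr K ≠ -3) (hH : SatisfiesHeegnerHypothesis (W.conductorNorm ℤ) K)
    (Dt : ModularParametrizationData W (W.conductorNorm ℤ)) (hc : Odd Dt.c) (β : ℤ) (ι : K →+* ℂ) (d₁ : KolyvaginHeegnerData Dt β ι 1)
    (hy : ¬ IsOfFinAddOrder d₁.derivedPoint) (M₀ : ℕ)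
    (hdiv : ∃ Q : (W.baseChange (ringClassField K ι 1)).toAffine.Point, ((2 ^ M₀ : ℕ) : ℤ) • Q = d₁.derivedPoint)
    (hndiv : ¬ ∃ Q : (W.baseChange (ringClassField K ι 1)).toAffine.Point, ((2 ^ (M₀ + 1) : ℕ) : ℤ) • Q = d₁.derivedPoint)
    (Wd : WeierstrassCurve ℚ) [Wd.IsElliptic] [Wd.IsGloballyMinimal]
    (hWd : ∃ C : VariableChange ℚ, C • W.quadraticTwist (NumberField.discr K : ℚ) = Wd)
    (hbudget : (W.Δ < 0 ∧ padicValNat 2 Wd.tamagawaProduct ≤ 1) ∨ padicValNat 2 Wd.tamagawaProduct = 0) (hBSDd : BSDp Wd 2)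
    (n₀ : ℕ) (e₀ : KolyvaginHeegnerData Dt β ι n₀) (hn₀ : Squarefree n₀)
    (hKoly : ∀ ℓ ∈ n₀.primeFactors, Zhang2014.IsKolyvaginPrime (W.conductorNorm ℤ) W K 2 ℓ ∧ 2 ≤ Zhang2014.kolyvaginIndex W 2 ℓ ∧
      ∃ (v : HeightOneSpectrum (𝓞 ℚ)) (𝔓 : Ideal (absIntegers (𝓞 ℚ) ℚ)) (h : absoluteGaloisGroup ℚ),
        ((ℓ : ℕ) : 𝓞 ℚ) ∈ v.asIdeal ∧ 𝔓 ∈ v.primesAbove ∧ IsArithFrobAt (𝓞 ℚ) h 𝔓 ∧ ∃ u : W.geomTorsion ((2 : ℕ) : ℤ), h • u ≠ u)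
    (he₀ : ¬ ∃ Q : (W.baseChange (ringClassField K ι n₀)).toAffine.Point, (2 : ℤ) • Q = e₀.derivedPoint) :
    BSDp W 2 := by
  have hw : W.rootNumber = -1 := TwinSwapBit.rootNumber_eq_neg_one_of_analyticRank_eq_one W hr Dt
  have hc0 : Dt.c ≠ 0 := by
    obtain ⟨k, hk⟩ := hc
    omega
  obtain ⟨Cd, hCd⟩ := hWd
  have hsha := natCard_sha_baseChange_mul_eq_pow_onOddCut_of_transpositionWitness hQ2 W hcm hT v h2v hNv hmult K hK hodd h3 hH hρ Dt hc β ι d₁ hy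
    M₀ hdiv hndiv hw hSel Cd hCd hbudget n₀ e₀ hn₀ hKoly he₀
  exact AnalyticTwin.swappedPairDescentAtTwo_shaDepth_anyTwin_of_facts hGZ hGZK hmod hMilneC W hr hSel K hK hodd h3 hH Dt hc0 β ι d₁ hy M₀ hdiv
    hndiv hsha Wd ⟨Cd, hCd⟩ hBSDd

/-! ## §5 The census form: U₂ on the whole odd habitat cut from WALL row 1 + PRINT + Q2 + a transposition-witness supply -/

/-- **U₂ ON THE WHOLE ODD HABITAT CUT (EITHER SIGN OF `Δ`) ⟸ WALL row 1 + PRINT + Q2 + TRANSPOSITION-WITNESS SUPPLY^±.**  Displayed hypotheses: S1′ =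
`BSD₂` for every non-CM globally minimal curve of analytic rank `0` (WALL row 1 of route ByReductionTypeAtTwo); the four PRINT facts; Q2; and the
SUPPLY: for every `W` on the cut (non-CM, `r_an = 1`, `#Sel₂ = 2`, `C(W)` odd, an odd multiplicative prime, `ρ_{W,2^∞}` onto — NO sign of `Δ`) ONE odd
Heegner frame `K ≠ ℚ(√−3)` with an odd-`c` datum, `P(1)` of infinite order and its exact depth `M₀`, a globally minimal twin model `Wd` inside the budget
`(Δ_W < 0 ∧ ord₂ C(Wd) ≤ 1) ∨ ord₂ C(Wd) = 0`, and a square-free `n` of TRANSPOSITION-deep Kolyvagin primes (Zhang-admissible at `2`, index `≥ 2`, an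
arithmetic Frobenius at `ℓ` moves a point of `W[2]`) with `P(n) ∉ 2W(K[n])`.  Then `BSD₂(W)` for every `W` on the cut (the twin is non-CM — same `j` —
of analytic rank `0` by Gross–Zagier, so S1′ pays `BSD₂(Wd)`).  CONDITIONAL on every displayed hypothesis; the supply is OPEN (the `ε = −1` mirror of
the route's K₄ supplies, both signs); closes nothing; BSD is NOT proved.
[cite: Kolyvagin1989Izv, Thm. A, Thm. B_l] [cite: Kolyvagin1991MathAnn, Thm. 2.1–2.2] [cite: GrossZagier1986, V.§2 (2.2)] [cite: WZhang2014, Thm. 1.1] -/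
theorem minimalTwinBSDTwo_onOddCut_of_wall_of_transpositionWitnessSupply_of_facts (hQ2 : KolyvaginRelationAtTwo)
    (hGZ : ∀ (N : ℕ) [NeZero N] (W : WeierstrassCurve ℚ) (K : Type) [Field K] [NumberField K], gross_zagier N W K)
    (hGZK : rank_eq_analyticRank_of_analyticRank_le_one) (hmod : hasEntireLFunction_rat)
    (hMilneC : Milne1972.bsdQuotient_baseChange_quadratic_anyModel)
    (hS1 : ∀ (W : WeierstrassCurve ℚ) [W.IsElliptic] [W.IsGloballyMinimal], ¬ W.HasCM → W.analyticRank = 0 → BSDp W 2)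
    (hSupply : ∀ (W : WeierstrassCurve ℚ) [W.IsElliptic] [W.IsGloballyMinimal] [NeZero (W.conductorNorm ℤ)],
      ¬ W.HasCM → W.analyticRank = 1 → Nat.card (W.selmerGroup 2) = 2 → Odd W.tamagawaProduct →
      (∀ n : ℕ, 0 < n → W.HasSurjectiveModNGaloisRep ((2 : ℤ) ^ n)) →
      (∃ v : HeightOneSpectrum (𝓞 ℚ), ((2 : ℕ) : 𝓞 ℚ) ∉ v.asIdeal ∧ ((W.conductorNorm ℤ : ℕ) : 𝓞 ℚ) ∈ v.asIdeal ∧ W.HasMultiplicativeReductionAt v) →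
      ∃ (K : Type) (_ : Field K) (_ : NumberField K), IsImaginaryQuadratic K ∧ Odd (NumberField.discr K) ∧ NumberField.discr K ≠ -3 ∧
        SatisfiesHeegnerHypothesis (W.conductorNorm ℤ) K ∧
        ∃ (Dt : ModularParametrizationData W (W.conductorNorm ℤ)) (β : ℤ) (ι : K →+* ℂ) (d₁ : KolyvaginHeegnerData Dt β ι 1) (M₀ : ℕ),
          Odd Dt.c ∧ ¬ IsOfFinAddOrder d₁.derivedPoint ∧
          (∃ Q : (W.baseChange (ringClassField K ι 1)).toAffine.Point, ((2 ^ M₀ : ℕ) : ℤ) • Q = d₁.derivedPoint) ∧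
          (¬ ∃ Q : (W.baseChange (ringClassField K ι 1)).toAffine.Point, ((2 ^ (M₀ + 1) : ℕ) : ℤ) • Q = d₁.derivedPoint) ∧
          (∃ (Wd : WeierstrassCurve ℚ) (_ : Wd.IsElliptic) (_ : Wd.IsGloballyMinimal),
            (∃ C : VariableChange ℚ, C • W.quadraticTwist (NumberField.discr K : ℚ) = Wd) ∧
              ((W.Δ < 0 ∧ padicValNat 2 Wd.tamagawaProduct ≤ 1) ∨ padicValNat 2 Wd.tamagawaProduct = 0)) ∧
          ∃ (n : ℕ) (d : KolyvaginHeegnerData Dt β ι n), Squarefree n ∧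
            (∀ ℓ ∈ n.primeFactors, Zhang2014.IsKolyvaginPrime (W.conductorNorm ℤ) W K 2 ℓ ∧ 2 ≤ Zhang2014.kolyvaginIndex W 2 ℓ ∧
              ∃ (v : HeightOneSpectrum (𝓞 ℚ)) (𝔓 : Ideal (absIntegers (𝓞 ℚ) ℚ)) (h : absoluteGaloisGroup ℚ),
                ((ℓ : ℕ) : 𝓞 ℚ) ∈ v.asIdeal ∧ 𝔓 ∈ v.primesAbove ∧ IsArithFrobAt (𝓞 ℚ) h 𝔓 ∧ ∃ u : W.geomTorsion ((2 : ℕ) : ℤ), h • u ≠ u) ∧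
            ¬ ∃ Q : (W.baseChange (ringClassField K ι n)).toAffine.Point, (2 : ℤ) • Q = d.derivedPoint) :
    ∀ (W : WeierstrassCurve ℚ) [W.IsElliptic] [W.IsGloballyMinimal] [NeZero (W.conductorNorm ℤ)],
      ¬ W.HasCM → W.analyticRank = 1 → Nat.card (W.selmerGroup 2) = 2 → Odd W.tamagawaProduct →
      (∀ n : ℕ, 0 < n → W.HasSurjectiveModNGaloisRep ((2 : ℤ) ^ n)) →
      (∃ v : HeightOneSpectrum (𝓞 ℚ), ((2 : ℕ) : 𝓞 ℚ) ∉ v.asIdeal ∧ ((W.conductorNorm ℤ : ℕ) : 𝓞 ℚ) ∈ v.asIdeal ∧ W.HasMultiplicativeReductionAt v) →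
      BSDp W 2 := by
  intro W _ _ _ hcm hr hSel hT hρ hv
  obtain ⟨K, _, _, hK, hodd, h3, hH, Dt, β, ι, d₁, M₀, hc, hy, hdiv, hndiv, ⟨Wd, _, _, ⟨Cd, hCd⟩, hbudget⟩, n, d, hn, hdeep, hPn⟩ :=
    hSupply W hcm hr hSel hT hρ hv
  obtain ⟨v, h2v, hNv, hmult⟩ := hv
  -- the twin model is non-CM (same `j`) of analytic rank `0` (Gross–Zagier: `L′(W/K,1) = L′(W,1)·L(W^{(d_K)},1) ≠ 0`), so `BSD₂(Wd)` by S1′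
  have hD0 : (NumberField.discr K : ℚ) ≠ 0 := by exact_mod_cast NumberField.discr_ne_zero K
  haveI hTell : (W.quadraticTwist (NumberField.discr K : ℚ)).IsElliptic := W.isElliptic_quadraticTwist hD0
  obtain ⟨Ph, hPh, hPhmap⟩ := AdditiveKoly.exists_isHeegnerPoint_map_eq_derivedPoint_one (W := W) (K := K) (Dt := Dt) (β := β)
    (ι := ι) hK hH d₁
  have hPinf : ¬ IsOfFinAddOrder Ph := by
    intro hfin
    apply hy
    rw [← hPhmap]
    exact (WeierstrassCurve.Affine.Point.map (W' := W) (algebraMap K (ringClassField K ι 1)).toRatAlgHom).isOfFinAddOrder hfin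
  have hrT : (W.quadraticTwist (NumberField.discr K : ℚ)).analyticRank = 0 :=
    analyticRank_twist_eq_zero_of_rankOne W K (hGZ _ W K) hmod hK hH hr hPh hPinf
  subst hCd
  have hcmd : ¬ (Cd • W.quadraticTwist (NumberField.discr K : ℚ)).HasCM := by
    rw [hasCM_iff_of_j_eq (((W.quadraticTwist (NumberField.discr K : ℚ)).variableChange_j Cd).trans (W.j_quadraticTwist hD0))]
    exact hcm
  have hrd : (Cd • W.quadraticTwist (NumberField.discr K : ℚ)).analyticRank = 0 := by
    rw [analyticRank_smul]
    exact hrT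
  exact bsdp_onOddCut_of_transpositionWitness_of_facts hQ2 hGZ hGZK hmod hMilneC W hcm hr hSel hT v h2v hNv hmult hρ K hK hodd h3 hH Dt hc β ι d₁ hy
    M₀ hdiv hndiv (Cd • W.quadraticTwist (NumberField.discr K : ℚ)) ⟨Cd, rfl⟩ hbudget (hS1 _ hcmd hrd) n d hn hdeep hPn

/-! ## §6 On `Δ < 0` a `Frob_∞`-deep witness is a transposition-deep witness -/

/-- **On `Δ_W < 0`, a DEEP `Frob_ℓ = Frob_∞` witness clause is a TRANSPOSITION-deep witness clause**: complex conjugation moves a point of `W[2]` when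
the `2`-division cubic has exactly one real root (`GenusKolySign.exists_twoTorsion_frob_smul_ne_of_frobEqFrobInfty_of_Δ_neg`), so every prime of the
witness carries an arithmetic Frobenius moving a point of `W[2]`.  Pure bookkeeping between g31's SUPPLY⁻ clause and §5's SUPPLY^± clause.
[cite: GrossLMS1991, §3 (3.2)] [cite: SilvermanAEC2009, Cor. III.6.4 (b)] -/
theorem transpositionDeep_of_frobInftyDeep_of_Δ_neg (W : WeierstrassCurve ℚ) [W.IsElliptic] [W.IsGloballyMinimal] (hneg : W.Δ < 0)
    (K : Type) [Field K] [NumberField K] {n : ℕ}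
    (hdeep : ∀ ℓ ∈ n.primeFactors, Zhang2014.IsKolyvaginPrime (W.conductorNorm ℤ) W K 2 ℓ ∧ 2 ≤ Zhang2014.kolyvaginIndex W 2 ℓ ∧
      FrobEqFrobInfty W K 2 ℓ) :
    ∀ ℓ ∈ n.primeFactors, Zhang2014.IsKolyvaginPrime (W.conductorNorm ℤ) W K 2 ℓ ∧ 2 ≤ Zhang2014.kolyvaginIndex W 2 ℓ ∧
      ∃ (v : HeightOneSpectrum (𝓞 ℚ)) (𝔓 : Ideal (absIntegers (𝓞 ℚ) ℚ)) (h : absoluteGaloisGroup ℚ),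
        ((ℓ : ℕ) : 𝓞 ℚ) ∈ v.asIdeal ∧ 𝔓 ∈ v.primesAbove ∧ IsArithFrobAt (𝓞 ℚ) h 𝔓 ∧ ∃ u : W.geomTorsion ((2 : ℕ) : ℤ), h • u ≠ u := by
  intro ℓ hℓ
  obtain ⟨hZ, hidx, hF⟩ := hdeep ℓ hℓ
  obtain ⟨v, 𝔓, h, ⟨hv, h𝔓, hfr⟩, P, hP⟩ := GenusKolySign.exists_twoTorsion_frob_smul_ne_of_frobEqFrobInfty_of_Δ_neg W hneg hF
  exact ⟨hZ, hidx, v, 𝔓, h, hv, h𝔓, hfr, P, hP⟩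

end Summit.BirchSwinnertonDyer.BirchSwinnertonDyer.Theorems.GenusExact.TwinSwap.TwinAnnihilation

end
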